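import Summits.Parity.BatemanHorn.Theorems.SoloInformedDivisorStoreyGeneral

/-!
# The Erdős-constant conjecture `∑_{n≤x} τ(|g(n)|) ~ deg(g)·A_g·x log x` and its located-root-count form

Solo informed line (Parity / Bateman–Horn), session 136.  For `g ∈ ℤ[X]` irreducible of degree `d`, the standard
heuristic (`#{m ≤ y : m ∣ g(n)}` has mean `∑_{m≤y} ρ_g(m)/m ≈ A_g log y`, applied up to `y = √|g(n)| ≈ n^{d/2}`)
predicts `E τ(|g(n)|) ≈ d·A_g·log n`, i.e. `S_g(x) = ∑_{n≤x} τ(|g(n)|) ~ d·A_g·x log x`; Erdős (1952) proved only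
`x log x ≪ S_g(x) ≪ x log x` for `d ≥ 3`, and the asymptotic is OPEN for every `d ≥ 3` (for `d = 2` it is a theorem —
in this tree `SoloInformedDivisorStoreyGeneral.tendsto_polyDivisorSum_quadratic_div`).  We record the conjecture as a
`Prop` (no axiom, nothing assumed) together with its LOCATED form `Mid_g(x) ~ ((d−2)/2)·A_g·x log x`, and prove:

* `erdosDivisorSumAsymptotic_iff_located` — for every irreducible `g` of degree `≥ 2` the two conjectures are
  EQUIVALENT (kernel-checked consequence of the storey identity `S_g = 2Mid_g + 2A_g x log x + O(x)`);
* `erdosDivisorSumAsymptotic_of_natDegree_eq_two`, `locatedRootCountAsymptotic_of_natDegree_eq_two` — both HOLD in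
  degree `2`.

So for an irreducible cubic the whole open content of `S_g ~ 3A_g x log x` is `Mid_g(x) ~ (A_g/2)·x log x`: the number of
divisors of `g(n)`, `n ≤ x`, in the window `(x, √g(n)]` — roots of `g` modulo `m` at levels `x < m ≤ x^{3/2}`, beyond
every proved level of distribution.  Numerically (this line's E2/E7 runs, `X = 2·10⁶`): `Mid/(A X log X) = 0.39746`
(`k³+2`), `0.39785` (`k³+3`) against the finite-`X` heuristic `½(1 − 3/log X + 3X^{-1/3}/log X) = 0.39743` (limit `½`).
-/

open Finset Real Polynomial Filter Topology

namespace Summit.Parity.BatemanHorn.Theorems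

/-- **Erdős-constant conjecture** for `g`: `∑_{n≤x} τ(|g(n)|)/(x log x) → deg(g)·A_g`.  A `Prop`, not an axiom; open for
every irreducible `g` of degree `≥ 3`, a theorem in degree `2`. -/
def ErdosDivisorSumAsymptotic (g : ℤ[X]) : Prop :=
  Tendsto (fun x : ℕ => (polyDivisorSum g x : ℝ) / ((x : ℝ) * Real.log x)) atTop
    (𝓝 ((g.natDegree : ℝ) * rootLevelConst g))

/-- **Located-root-count conjecture** for `g`: `Mid_g(x)/(x log x) → ((deg g − 2)/2)·A_g`. -/
def LocatedRootCountAsymptotic (g : ℤ[X]) : Prop :=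
  Tendsto (fun x : ℕ => (polyLocatedRootCount g x : ℝ) / ((x : ℝ) * Real.log x)) atTop
    (𝓝 (((g.natDegree : ℝ) - 2) / 2 * rootLevelConst g))

/-- **Equivalence of the two conjectures** for every irreducible `g` of degree `≥ 2`:
`S_g ~ d·A_g·x log x ⟺ Mid_g ~ ((d−2)/2)·A_g·x log x`. [this work] -/
theorem erdosDivisorSumAsymptotic_iff_located {g : ℤ[X]} (hirr : Irreducible g) (hdeg : 2 ≤ g.natDegree) :
    ErdosDivisorSumAsymptotic g ↔ LocatedRootCountAsymptotic g := by
  have key := tendsto_polyDivisorSum_div_iff_of_two_le hirr hdeg ((g.natDegree : ℝ) * rootLevelConst g)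
  have hval : ((g.natDegree : ℝ) * rootLevelConst g - 2 * rootLevelConst g) / 2
      = ((g.natDegree : ℝ) - 2) / 2 * rootLevelConst g := by ring
  rw [hval] at key
  exact key

/-- **Degree 2: the Erdős-constant conjecture holds** (`S_g/(x log x) → 2A_g`). [this work] -/
theorem erdosDivisorSumAsymptotic_of_natDegree_eq_two {g : ℤ[X]} (hirr : Irreducible g)
    (hdeg : g.natDegree = 2) : ErdosDivisorSumAsymptotic g := by
  unfold ErdosDivisorSumAsymptotic
  rw [hdeg, Nat.cast_ofNat]
  exact tendsto_polyDivisorSum_quadratic_div hirr hdeg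

/-- **Degree 2: the located-root-count conjecture holds** (`Mid_g/(x log x) → 0`). [this work] -/
theorem locatedRootCountAsymptotic_of_natDegree_eq_two {g : ℤ[X]} (hirr : Irreducible g)
    (hdeg : g.natDegree = 2) : LocatedRootCountAsymptotic g :=
  (erdosDivisorSumAsymptotic_iff_located hirr (by omega)).mp
    (erdosDivisorSumAsymptotic_of_natDegree_eq_two hirr hdeg)

/-- **Degree 2, explicitly**: `Mid_g(x)/(x log x) → 0` for every irreducible quadratic `g`. [this work] -/
theorem tendsto_polyLocatedRootCount_div_of_natDegree_eq_two {g : ℤ[X]} (hirr : Irreducible g)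
    (hdeg : g.natDegree = 2) :
    Tendsto (fun x : ℕ => (polyLocatedRootCount g x : ℝ) / ((x : ℝ) * Real.log x)) atTop (𝓝 0) := by
  have h := locatedRootCountAsymptotic_of_natDegree_eq_two hirr hdeg
  unfold LocatedRootCountAsymptotic at h
  rw [hdeg] at h
  norm_num at h
  exact h

/-- **Cubic case of the equivalence**: for an irreducible cubic, `S_g/(x log x) → 3A_g ⟺ Mid_g/(x log x) → A_g/2`.
[this work] -/
theorem tendsto_polyDivisorSum_cubic_iff {g : ℤ[X]} (hirr : Irreducible g) (hdeg : g.natDegree = 3) :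
    Tendsto (fun x : ℕ => (polyDivisorSum g x : ℝ) / ((x : ℝ) * Real.log x)) atTop (𝓝 (3 * rootLevelConst g)) ↔
      Tendsto (fun x : ℕ => (polyLocatedRootCount g x : ℝ) / ((x : ℝ) * Real.log x)) atTop
        (𝓝 (rootLevelConst g / 2)) := by
  have key := tendsto_polyDivisorSum_div_iff_of_two_le hirr (by omega) (3 * rootLevelConst g)
  have hval : (3 * rootLevelConst g - 2 * rootLevelConst g) / 2 = rootLevelConst g / 2 := by ring
  rw [hval] at key
  exact key

end Summit.Parity.BatemanHorn.Theorems
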